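import Literature.NumberTheory.EllipticCurves.Disegni2020.PAdicBSDSplitMultiplicativeRankOne
import Literature.NumberTheory.EllipticCurves.Rank1Residual.X11RankOneCertificates.Claim
import Summits.BirchSwinnertonDyer.Rank1Residual.X11b.Three.CyclotomicNonsplit
import HarnessLib

/-!
# X11b at a SPLIT multiplicative prime `p ≥ 5`, (ram): the CYCLOTOMIC route as a class theorem modulo
# Schneider's non-degeneracy (team `x11b3` = N8/O2, sub-target T9-CYC-NS — the N8 half)

HONEST FRAMING (cell `b2b-bsdres`, run/shared/lean/b2b/bsd-rank1-residual/, verbatim): the goal of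
the cell is to DELETE the COMBINATION-SHAPED residual classes for ALL analytic-rank `≤ 1` elliptic
curves over `ℚ` — "full BSD formula for every rank `≤ 1` curve in class C" assembled STRICTLY from
published theorems — so that the rank-`≤ 1` remainder becomes exactly the CONSTRUCTION-SHAPED classes,
which are TYPED (missing-input `Prop`s), NOT attempted. This is not "finishing BSD". Team `x11b3` =
N8/O2 (X11b: `p ‖ N`, `r = 1`, `E[p]` irreducible); research route; no claim beyond the stated
sub-population; nothing booked; X11b stays CONSTRUCTION-SHAPED (N8 NEEDS X_C2 / O2 OPEN) — marks move
only by signed lines. THEOREMS ONLY (no definition, no named fact, no `sorry`). Companion of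
`X11b/Three/CyclotomicNonsplit.lean` (the NON-split half, every odd `p`).

## What this file proves

The split-multiplicative twin of `Three.bsdp_of_classX11b_of_nonsplit_of_ram_of_schneider`, at
`p ≥ 5` ONLY (the source's range: Disegni 2020 Thm. 4, second bullet, rests on Venerucci 2016,
"`p > 3`"; at `p = 3` the split half of O2 is NOT reached by this road):

* `bsdp_of_split_of_ram_of_schneider_datum` — datum level: `W` globally minimal, `p ≥ 5`, split
  multiplicative at `p` (Tate datum `Dq`), `E[p]` irreducible, (ram), `ord_{s=1} L(E,s) = 1`, cyclotomic
  `(κ, γ)`, newform `f`, dual datum `D`, `ϖ·Ω_E = Ω⁺_f`, THE split Mazur–Tate–Teitelbaum function `L`,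
  THE Stein–Wuthrich §4.2 height `Dh` at the split prime (`IsSplitMultCanonical Dh Dq` = Schneider's
  norm-adapted height) with `Reg_p(E, Dh) ≠ 0` (`SchneiderConjecture Dh`): `BSD(E,p)`. PUBLISHED
  inputs: Skinner 2016 Thm. A, split clause (`char_Λ X = (g)`, `ι(T·g·w) = ϖ·L`: the exceptional-zero
  factor `T`), Stein–Wuthrich 2013 Thm. 6.1 split (`thm61_splitMultiplicative`:
  `[T^r]f_E·log_p(γ_cyc)^{r+1}·#tors² ∼ 𝓛_p·#Ш[p^∞]·Reg_p·∏c_v`), Disegni 2020 Thm. 4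
  (`Disegni2020.thm4_padicBSD_splitMultiplicative_rankOne`: `ϖ·[T²]L·log_p(γ_cyc)²·#tors² ∼
  𝓛_p·#Ш_an·Reg_p·∏c_v` — Venerucci's exceptional-zero formula made exact, which needs a SECOND
  multiplicative prime `m ≠ p`: supplied by the (ram) prime), GZK. Mechanism: `f_E := g·w` generates
  `char_Λ X` with `ι(T·f_E) = ϖ·L`, so `[T²](ϖL) = [T¹]f_E`; the two displays share the left side,
  `𝓛_p ≠ 0` (Barré-Sirieix–Diaz–Gramain–Philibert, tree theorem `LInvariant_ne_zero_holds`) and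
  `Reg_p ≠ 0` cancel: `ord_p #Ш_an = ord_p #Ш[p^∞]`.
* `bsdp_of_classX11b_of_split_of_ram_of_schneider` — CLASS LEVEL: `ClassX11b W p` ∧ `5 ≤ p` ∧ split
  at `p` ∧ `Ram W p` ∧ [Schneider for THE §4.2 split height, quantified over the (unique) Tate datum
  and pinned height] `→ BSDp W p`; data instantiated from tree theorems / published existence facts
  (`exists_isSplitMultPAdicLFunctionOf` is a tree THEOREM; `exists_isSplitMultCanonical` SW §4.2).
* `bsdp_of_classX11b_of_ram_of_schneider_of_five_le` — both halves at `p ≥ 5`: X11b ∧ (ram) ∧ `p ≥ 5`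
  `→ BSD(E,p)` ⇐ PUBLISHED facts + Schneider's non-degeneracy AT THE PAIR (split: the norm-adapted
  height; non-split: formula (4.1)).

Honest status: on X11b ∧ (ram) ∧ `p ≥ 5` (row N8's (ram) part, split or not) `BSD(E,p)` ⇐ PUBLISHED
facts + ONE conjecture INSTANCE at the pair (Schneider 1985 / Mazur–Stein–Tate 2006 Conj. 1.1; open
for non-CM curves; per pair a numerical certificate). NOT reached: `p = 3` split (Disegni's (∗)),
pairs without a (ram) prime. CONDITIONAL; nothing booked; labels UNCHANGED.

References: [Skinner2016PacificMC] Thm. A (§1), §2.4, §3.2–3.3; [SteinWuthrich2013] Thm. 6.1 (p. 20),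
§3.4 (3.4), §4.2 (p. 16); [Disegni2020] Thm. 1, Thm. 4, §3.2.2; [Venerucci2016] Thm. A/C;
[MazurTateTeitelbaum1986] §II.10; [Miller2011LMS] Def. 1.1.
-/

set_option autoImplicit false

noncomputable section

open scoped Classical MatrixGroups ModularForm

open CongruenceSubgroup WeierstrassCurve Literature.NumberTheory.EllipticCurves
  Literature.NumberTheory.EllipticCurves.ModularForms
  Literature.NumberTheory.EllipticCurves.Rank1Residual
  Literature.NumberTheory.EllipticCurves.Rank1Residual.X11RankOneCertificates
  Literature.NumberTheory.EllipticCurves.Skinner2016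
  Literature.NumberTheory.EllipticCurves.SteinWuthrich2013
  Literature.NumberTheory.EllipticCurves.Disegni2020
  Literature.NumberTheory.EllipticCurves.Wuthrich2014

namespace Summit.BirchSwinnertonDyer.Rank1Residual.X11b.CyclotomicSplit

/-! ### Datum level -/

/-- **Split multiplicative `p ≥ 5`, (irr) + (ram), analytic rank one, Schneider at the datum ⇒
`BSD(E,p)`.** Inputs (PUBLISHED): Skinner 2016 Thm. A split clause (`hA`), Stein–Wuthrich 2013 Thm. 6.1
split (`hJ`), Disegni 2020 Thm. 4 second bullet (`hD`; its second multiplicative prime is the (ram)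
prime), GZK (`hGZK`); the `𝓛`-invariant is non-zero by the tree theorem `LInvariant_ne_zero_holds`.
Proof: `f_E := g·w` generates `char_Λ X`, `ι(T·f_E) = ϖ·L`, `[T²](ϖL) = [T¹]f_E`; both displays have the
left side `ϖ·[T²]L·log_p(γ_cyc)²·#tors²`; cancel `𝓛_p·Reg_p·∏c_v ≠ 0`. [cite: Skinner2016PacificMC, Thm. A (§1), §3.2]
[cite: SteinWuthrich2013, Thm. 6.1 (p. 20), §4.2 (p. 16)] [cite: Disegni2020, Thm. 4 and §3.2.2]
[cite: Miller2011LMS, Def. 1.1] -/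
theorem bsdp_of_split_of_ram_of_schneider_datum (hA : thmA_charIdeal_multiplicative)
    (hJ : thm61_splitMultiplicative) (hD : thm4_padicBSD_splitMultiplicative_rankOne)
    (hGZK : rank_eq_analyticRank_of_analyticRank_le_one)
    (W : WeierstrassCurve ℚ) [W.IsElliptic] [W.IsGloballyMinimal] (p : ℕ) [Fact p.Prime]
    {κ : ZpExtension ℚ p} {γ : Field.absoluteGaloisGroup ℚ} {N : ℕ} [NeZero N]
    {f : CuspForm (Gamma0 N) 2} (hp : 5 ≤ p) (hr : W.analyticRank = 1) (Dq : TateParameterData W p)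
    (hirr : W.HasIrreducibleModPGaloisRep p) (hram : Ram W p) (hκ : κ.IsCyclotomic)
    (hγ : κ.IsTopGenerator γ) (hγ' : IsCyclotomicVariable p γ) (hf : IsNewformOf W f)
    (D : W.SelmerDualData κ γ) (ϖ : ℚ) (hϖ0 : ϖ ≠ 0) (hϖ : (ϖ : ℝ) * W.realPeriodRat = plusPeriod f)
    (L : PowerSeries ℚ_[p]) (hL : IsSplitMultPAdicLFunctionOf f p L)
    (Dh : PAdicHeightData W p) (hDh : IsSplitMultCanonical Dh Dq) (hSch : SchneiderConjecture Dh) :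
    BSDp W p := by
  have hp2 : p ≠ 2 := by omega
  have hp3 : 3 ≤ p := by omega
  have hsplit : W.HasSplitMultiplicativeReductionAtPrime p := Dq.split
  have hmult : W.HasMultiplicativeReductionAtPrime p := hsplit.hasMultiplicativeReductionAtPrime
  -- Gross–Zagier–Kolyvagin
  obtain ⟨hrk, hfin⟩ := hGZK W (le_of_eq hr)
  haveI : Finite W.sha := hfin
  have hfinp : Finite (AddCommGroup.primaryComponent W.sha p) := inferInstance
  set r := W.mordellWeilRank with hr_def
  -- Skinner 2016 Thm. A (split clause): torsion, `char_Λ X = (g)`, `ι(T·g·w) = ϖ·L`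
  haveI : Module.Finite (IwasawaAlgebra p) D.X := D.module_finite_holds hγ
  obtain ⟨hXtors, g, hchar, hsp, -⟩ := hA W p hp3 hmult hirr hram hκ hγ hγ' hf D ϖ hϖ0 hϖ
  obtain ⟨w, hw⟩ := hsp hsplit L hL
  set fE : IwasawaAlgebra p := g * (w : IwasawaAlgebra p) with hfE_def
  have hcharE : D.charIdeal = Ideal.span {fE} := by
    rw [hchar, hfE_def, Ideal.span_singleton_mul_right_unit w.isUnit]
  have hw' : iwasawaToPowerSeries p ((PowerSeries.X : IwasawaAlgebra p) * fE) =
      PowerSeries.C ((ϖ : ℚ) : ℚ_[p]) * L := by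
    rw [hfE_def, ← mul_assoc]; exact hw
  -- `[T^(r+1)] (ϖ L) = [T^r] fE`
  have hcoeff : ((PowerSeries.coeff r fE : ℤ_[p]) : ℚ_[p]) =
      (ϖ : ℚ_[p]) * PowerSeries.coeff (r + 1) L := by
    rw [← PowerSeries.coeff_succ_X_mul r fE, ← coeff_iwasawaToPowerSeries p _ (r + 1), hw',
      PowerSeries.coeff_C_mul]
  -- Stein–Wuthrich Thm. 6.1 (split) at the generator `fE`
  obtain ⟨-, -, h3⟩ := hJ W p hp2 Dq κ γ hκ hγ hγ' D hXtors fE hcharE Dh hDh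
  obtain ⟨u, hu⟩ := h3 hSch hfinp
  -- Disegni 2020 Thm. 4 (split, exact form: the (ram) prime is a second multiplicative prime)
  have hm : ∃ m : ℕ, ∃ _ : Fact m.Prime, m ≠ p ∧ W.HasMultiplicativeReductionAtPrime m := by
    obtain ⟨ℓ, hℓ, hℓp, hmℓ, -⟩ := hram
    exact ⟨ℓ, hℓ, hℓp, hmℓ⟩
  obtain ⟨s, u', hs, hs0, hdis⟩ := (hD W p hp Dq hirr hm hr Dh hDh f hf L hL ϖ hϖ).2.2
  rw [← hrk] at hdis
  -- abbreviations
  set Shp : ℚ_[p] := (Nat.card (AddCommGroup.primaryComponent W.sha p) : ℚ_[p]) with hShp_def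
  set Rg : ℚ_[p] := padicRegulator Dh with hRg_def
  set Cc : ℚ_[p] := (W.tamagawaProduct : ℚ_[p]) with hCc_def
  set Li : ℚ_[p] := LInvariant Dq with hLi_def
  have hRg0 : Rg ≠ 0 := hSch
  have hCc0 : Cc ≠ 0 := by
    rw [hCc_def]; exact_mod_cast (W.tamagawaProduct_pos_holds : 0 < W.tamagawaProduct).ne'
  have hLi0 : Li ≠ 0 := LInvariant_ne_zero_holds Dq
  -- the two displays share the left side
  have key : ((u : ℤ_[p]) : ℚ_[p]) * (Li * (Shp * Rg * Cc)) =
      ((u' : ℤ_[p]) : ℚ_[p]) * (Li * ((s : ℚ_[p]) * Rg * Cc)) := by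
    rw [← hdis, ← hu, hcoeff]
  have key2 : ((u : ℤ_[p]) : ℚ_[p]) * Shp = ((u' : ℤ_[p]) : ℚ_[p]) * (s : ℚ_[p]) := by
    apply mul_right_cancel₀ (mul_ne_zero (mul_ne_zero hLi0 hRg0) hCc0)
    linear_combination key
  -- valuations: `ord_p #Ш_an = ord_p #Ш[p^∞]`
  have hval : padicValRat p s = padicValNat p (Nat.card (AddCommGroup.primaryComponent W.sha p)) := by
    have hShp0 : Shp ≠ 0 := by rw [hShp_def]; exact_mod_cast Nat.card_pos.ne'
    have hsQ0 : ((s : ℚ) : ℚ_[p]) ≠ 0 := by exact_mod_cast hs0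
    have h := congrArg Padic.valuation key2
    rw [Padic.valuation_mul (coe_units_ne_zero p u) hShp0,
      Padic.valuation_mul (coe_units_ne_zero p u') hsQ0, valuation_coe_units_eq_zero,
      valuation_coe_units_eq_zero, zero_add, zero_add, hShp_def, Padic.valuation_natCast,
      Padic.valuation_ratCast] at h
    exact h.symm
  exact ⟨hrk, hfinp, s, hs, hval⟩

/-! ### Class level: X11b ∧ split ∧ (ram), `p ≥ 5` -/

/-- **X11b ∧ split multiplicative at `p` ∧ (ram), `p ≥ 5`: `BSD(E,p)` from PUBLISHED named facts plus
Schneider's non-degeneracy AT THE PAIR** (for THE §4.2 split height = Schneider's norm-adapted height,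
quantified over the unique Tate datum and pinned height). Named facts: Skinner 2016 Thm. A `hA`,
Stein–Wuthrich Thm. 6.1 split `hJ`, Disegni 2020 Thm. 4 `hD`, SW §4.2 existence `hH`, GZK `hGZK`,
modularity `hpar`; the split MTT function exists by the tree THEOREM `exists_isSplitMultPAdicLFunctionOf`.
NO Heegner datum, no `p ∤ ∏ c_ℓ`, no `p ∤ #Ш_an`. CONDITIONAL on Schneider; nothing booked; X11b
stays CONSTRUCTION-SHAPED. [cite: Skinner2016PacificMC, Thm. A (§1), §3.2]
[cite: SteinWuthrich2013, Thm. 6.1 (p. 20), §4.2 (p. 16)] [cite: Disegni2020, Thm. 4 and §3.2.2]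
[cite: MazurTateTeitelbaum1986, §I.10–I.14, §II.10] [cite: Miller2011LMS, Def. 1.1] -/
theorem bsdp_of_classX11b_of_split_of_ram_of_schneider (hA : thmA_charIdeal_multiplicative)
    (hJ : thm61_splitMultiplicative) (hD : thm4_padicBSD_splitMultiplicative_rankOne)
    (hH : exists_isSplitMultCanonical) (hGZK : rank_eq_analyticRank_of_analyticRank_le_one)
    (hpar : nonempty_modularParametrizationData)
    (W : WeierstrassCurve ℚ) [W.IsElliptic] [W.IsGloballyMinimal] (p : ℕ) [Fact p.Prime]
    (hp : 5 ≤ p) (hX : ClassX11b W p) (hsplit : W.HasSplitMultiplicativeReductionAtPrime p)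
    (hram : Ram W p)
    (hSch : ∀ (Dq : TateParameterData W p) (Dh : PAdicHeightData W p), IsSplitMultCanonical Dh Dq →
      SchneiderConjecture Dh) :
    BSDp W p := by
  obtain ⟨hran, -, -, hirr⟩ := hX
  have hp2 : p ≠ 2 := by omega
  obtain ⟨κ, hκ, γ, hγ, hγ'⟩ := exists_isCyclotomic_isTopGenerator_isCyclotomicVariable_holds p
  obtain ⟨D⟩ := W.nonempty_selmerDualData_holds κ γ hγ
  haveI : NeZero (W.conductorNorm ℤ) := ⟨(W.conductorNorm_pos_holds).ne'⟩
  obtain ⟨Dm⟩ := hpar W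
  obtain ⟨ϖ, hϖpos, hϖ, -⟩ := Dm.exists_rat_mul_realPeriodRat_eq_plusPeriod
  obtain ⟨L, hL⟩ := exists_isSplitMultPAdicLFunctionOf hsplit Dm.isNewformOf
  obtain ⟨Dq⟩ := (nonempty_tateParameterData_iff_holds (W := W) (p := p)).mpr hsplit
  obtain ⟨Dh, hDh⟩ := hH W p hp2 Dq
  exact bsdp_of_split_of_ram_of_schneider_datum hA hJ hD hGZK W p hp hran Dq hirr hram hκ hγ hγ'
    Dm.isNewformOf D ϖ hϖpos.ne' hϖ L hL Dh hDh (hSch Dq Dh hDh)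

/-- **X11b ∧ (ram), `p ≥ 5`, BOTH reduction types at `p`: `BSD(E,p)` from PUBLISHED named facts plus
Schneider's non-degeneracy AT THE PAIR** — split: this file; non-split:
`Three.bsdp_of_classX11b_of_nonsplit_of_ram_of_schneider` (every odd `p`). The Schneider input is asked
for THE pinned §4.2 height of the pair's reduction type. This is row N8 ∩ (ram) of the residual map
reduced to Schneider's conjecture INSTANCES (the cell's currency for X_C1 ↦ Greenberg's μ-instance and
for O7-ord); pairs of X11b without a (ram) prime and the split half at `p = 3` are NOT reached.
CONDITIONAL; nothing booked; no label change. [cite: Skinner2016PacificMC, Thm. A (§1)]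
[cite: SteinWuthrich2013, Thm. 6.1 (p. 20)] [cite: Disegni2020, Thm. 1 and Thm. 4] [cite: Miller2011LMS, Def. 1.1] -/
theorem bsdp_of_classX11b_of_ram_of_schneider_of_five_le (hA : thmA_charIdeal_multiplicative)
    (hJs : thm61_splitMultiplicative) (hJn : thm61_nonsplitMultiplicative)
    (hDs : thm4_padicBSD_splitMultiplicative_rankOne) (hDn : thm1_padicBSD_nonsplitMultiplicative)
    (hHs : exists_isSplitMultCanonical) (hHn : exists_isMultCanonical)
    (hLns : exists_isMultPAdicLFunctionOf_neg_one)
    (hGZK : rank_eq_analyticRank_of_analyticRank_le_one) (hpar : nonempty_modularParametrizationData)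
    (W : WeierstrassCurve ℚ) [W.IsElliptic] [W.IsGloballyMinimal] (p : ℕ) [Fact p.Prime]
    (hp : 5 ≤ p) (hX : ClassX11b W p) (hram : Ram W p)
    (hSchS : ∀ (Dq : TateParameterData W p) (Dh : PAdicHeightData W p), IsSplitMultCanonical Dh Dq →
      SchneiderConjecture Dh)
    (hSchN : ¬ W.HasSplitMultiplicativeReductionAtPrime p →
      ∀ q : ℚ_[p], q ≠ 0 → ‖q‖ < 1 → tateJ q = (W.j : ℚ_[p]) →
        ∀ Dh : PAdicHeightData W p, IsMultCanonical Dh q → SchneiderConjecture Dh) :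
    BSDp W p := by
  by_cases hsplit : W.HasSplitMultiplicativeReductionAtPrime p
  · exact bsdp_of_classX11b_of_split_of_ram_of_schneider hA hJs hDs hHs hGZK hpar W p hp hX hsplit hram
      hSchS
  · exact Three.bsdp_of_classX11b_of_nonsplit_of_ram_of_schneider hA hJn hDn hHn hLns hGZK hpar W p
      (by omega) hX hsplit hram (hSchN hsplit)

end Summit.BirchSwinnertonDyer.Rank1Residual.X11b.CyclotomicSplit

end
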